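import Mathlib.Topology.Algebra.InfiniteSum.Real
import Mathlib.Algebra.BigOperators.Ring.Finset
import Mathlib.Data.Fintype.BigOperators
import HarnessLib

/-!
# Route `GreenTaoLevelTwo`, crux `MNTwo` (stmt-Parity-21276), line `birth`: product weights on
# `ℤ^I` — summability and tails outside a box (the harmonic-analysis core of
# `stub_verticalReduction`, V)

Pure bookkeeping for the truncation of the vertical Fourier series: for a nonnegative weight
`w : ℤ → ℝ` whose symmetric partial sums are bounded (`∑_{|k| ≤ K'} w(k) ≤ A`) and whose
partial sums away from `[-K, K]` are small (`∑_{K < |k| ≤ K'} w(k) ≤ T`), the product weight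
`W(n) = ∏ᵢ w(nᵢ)` on `ℤ^I` satisfies

* `∑_{n ∈ u} W(n) ≤ A^{|I|}` for every finite `u` (`sum_prod_le_pow`), hence `W` is summable
  (`summable_prod_weight`);
* `∑_{n ∈ u} W(n) ≤ |I| A^{|I|-1} T` for every finite `u` avoiding the box `[-K, K]^I`
  (`sum_prod_le_of_not_mem_box`: a point outside the box has a bad coordinate; sum over the bad
  coordinate first), hence the same bound for `∑_{n ∉ box} W(n)` (`tsum_compl_box_le`).

Applied to the squared smoothing multipliers `w(k) = min(1, (π s |k|)⁻¹)²` (`w(0) = 1`) of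
`…MNTwoVerticalMultiplier` / `…MNTwoVerticalTruncation`, this is the polynomial tail control of
Green–Tao 2012a Lemma 3.7.

References: B. Green, T. Tao, *The Möbius function is strongly orthogonal to nilsequences*,
Ann. of Math. 175 (2012), Lemma 3.7 and App. A [GreenTao2012Mobius].
-/

namespace Summit.Parity.GeneralizedHardyLittlewood.GreenTaoLevelTwoMNTwoVerticalWeights

variable {I : Type} [Fintype I] [DecidableEq I]

/-! ### §1 Boxes -/

/-- Sum of a product weight over the box `[-K, K]^I` = product of the one-dimensional sums.
[folklore] -/
theorem sum_box_prod_eq (w : ℤ → ℝ) (K : ℕ) :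
    ∑ n ∈ Fintype.piFinset (fun _ : I => Finset.Icc (-(K : ℤ)) K), ∏ i, w (n i) =
      ∏ _i : I, ∑ k ∈ Finset.Icc (-(K : ℤ)) K, w k := by
  rw [Finset.prod_univ_sum]

/-- Every finite set of frequencies lies in some box. [folklore] -/
theorem exists_subset_box (u : Finset (I → ℤ)) :
    ∃ K : ℕ, u ⊆ Fintype.piFinset (fun _ : I => Finset.Icc (-(K : ℤ)) K) := by
  refine ⟨u.sup fun n => Finset.univ.sup fun i => (n i).natAbs, fun n hn => ?_⟩
  rw [Fintype.mem_piFinset]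
  intro i
  have h1 : (n i).natAbs ≤ u.sup fun n => Finset.univ.sup fun i => (n i).natAbs :=
    le_trans (Finset.le_sup (f := fun i => (n i).natAbs) (Finset.mem_univ i))
      (Finset.le_sup (f := fun n : I → ℤ => Finset.univ.sup fun i => (n i).natAbs) hn)
  rw [Finset.mem_Icc]
  constructor <;> omega

/-! ### §2 Bounded partial sums and summability -/

/-- **Partial sums of a product weight are bounded by `A^{|I|}`.** [folklore] -/
theorem sum_prod_le_pow (w : ℤ → ℝ) (hw : ∀ k, 0 ≤ w k) {A : ℝ}
    (hA : ∀ K : ℕ, ∑ k ∈ Finset.Icc (-(K : ℤ)) K, w k ≤ A) (u : Finset (I → ℤ)) :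
    ∑ n ∈ u, ∏ i, w (n i) ≤ A ^ Fintype.card I := by
  obtain ⟨K, hK⟩ := exists_subset_box u
  calc ∑ n ∈ u, ∏ i, w (n i)
      ≤ ∑ n ∈ Fintype.piFinset (fun _ : I => Finset.Icc (-(K : ℤ)) K), ∏ i, w (n i) :=
        Finset.sum_le_sum_of_subset_of_nonneg hK fun m _ _ => Finset.prod_nonneg fun j _ => hw (m j)
    _ = ∏ _i : I, ∑ k ∈ Finset.Icc (-(K : ℤ)) K, w k := sum_box_prod_eq w K
    _ ≤ ∏ _i : I, A :=
        Finset.prod_le_prod (fun i _ => Finset.sum_nonneg fun k _ => hw k) fun i _ => hA K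
    _ = A ^ Fintype.card I := by simp

/-- **A product weight with bounded one-dimensional partial sums is summable on `ℤ^I`.**
[folklore] -/
theorem summable_prod_weight (w : ℤ → ℝ) (hw : ∀ k, 0 ≤ w k) {A : ℝ}
    (hA : ∀ K : ℕ, ∑ k ∈ Finset.Icc (-(K : ℤ)) K, w k ≤ A) :
    Summable fun n : I → ℤ => ∏ i, w (n i) :=
  summable_of_sum_le (fun m => Finset.prod_nonneg fun j _ => hw (m j)) (sum_prod_le_pow w hw hA)

/-! ### §3 Tails outside a box -/

/-- **Sums over finite sets avoiding the box `[-K,K]^I`**: bounded by `|I| A^{|I|-1} T`, where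
`T` bounds the one-dimensional partial sums away from `[-K, K]`. [folklore] -/
theorem sum_prod_le_of_not_mem_box (w : ℤ → ℝ) (hw : ∀ k, 0 ≤ w k) {A T : ℝ}
    (hA : ∀ K' : ℕ, ∑ k ∈ Finset.Icc (-(K' : ℤ)) K', w k ≤ A) (K : ℕ)
    (hT : ∀ K' : ℕ, ∑ k ∈ Finset.Icc (-(K' : ℤ)) K' \ Finset.Icc (-(K : ℤ)) K, w k ≤ T)
    (u : Finset (I → ℤ))
    (hu : ∀ n ∈ u, n ∉ Fintype.piFinset (fun _ : I => Finset.Icc (-(K : ℤ)) K)) :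
    ∑ n ∈ u, ∏ i, w (n i) ≤ Fintype.card I * A ^ (Fintype.card I - 1) * T := by
  obtain ⟨K', hK'⟩ := exists_subset_box u
  have hT0 : 0 ≤ T := le_trans (Finset.sum_nonneg fun k _ => hw k) (hT 0)
  -- each `n ∈ u` has a bad coordinate
  have hbad : ∀ n ∈ u, ∃ i, n i ∉ Finset.Icc (-(K : ℤ)) K := by
    intro n hn
    by_contra h
    push Not at h
    exact hu n hn (Fintype.mem_piFinset.mpr h)
  -- the sub-boxes with a prescribed bad coordinate
  set t : I → I → Finset ℤ := fun i j =>
    if j = i then Finset.Icc (-(K' : ℤ)) K' \ Finset.Icc (-(K : ℤ)) K else Finset.Icc (-(K' : ℤ)) K'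
    with ht
  set B : I → Finset (I → ℤ) := fun i => Fintype.piFinset (t i) with hB
  have hcover : ∀ n ∈ u, ∃ i, n ∈ B i := by
    intro n hn
    obtain ⟨i, hi⟩ := hbad n hn
    refine ⟨i, Fintype.mem_piFinset.mpr fun j => ?_⟩
    have hnK' := Fintype.mem_piFinset.mp (hK' hn)
    by_cases hji : j = i
    · subst hji
      simp only [ht, if_true]
      exact Finset.mem_sdiff.mpr ⟨hnK' j, hi⟩
    · simp only [ht, hji, if_false]
      exact hnK' j
  have hWn : ∀ n : I → ℤ, 0 ≤ ∏ j, w (n j) := fun n => Finset.prod_nonneg fun j _ => hw _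
  -- sum over the sub-boxes
  have hbox : ∀ i, ∑ n ∈ B i, ∏ j, w (n j) ≤ A ^ (Fintype.card I - 1) * T := by
    intro i
    rw [hB]
    simp only
    rw [← Finset.prod_univ_sum, ← Finset.mul_prod_erase Finset.univ _ (Finset.mem_univ i)]
    have hi : (∑ k ∈ t i i, w k) ≤ T := by
      simp only [ht, if_true]
      exact hT K'
    have hrest : ∏ j ∈ Finset.univ.erase i, ∑ k ∈ t i j, w k ≤ ∏ _j ∈ Finset.univ.erase i, A := by
      refine Finset.prod_le_prod (fun j _ => Finset.sum_nonneg fun k _ => hw k) fun j hj => ?_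
      have hji : j ≠ i := Finset.ne_of_mem_erase hj
      simp only [ht, hji, if_false]
      exact hA K'
    have hA0 : 0 ≤ A := le_trans (Finset.sum_nonneg fun k _ => hw k) (hA 0)
    calc (∑ k ∈ t i i, w k) * ∏ j ∈ Finset.univ.erase i, ∑ k ∈ t i j, w k
        ≤ T * ∏ _j ∈ Finset.univ.erase i, A :=
          mul_le_mul hi hrest (Finset.prod_nonneg fun j _ => Finset.sum_nonneg fun k _ => hw k) hT0
      _ = A ^ (Fintype.card I - 1) * T := by
          rw [Finset.prod_const, Finset.card_erase_of_mem (Finset.mem_univ i), Finset.card_univ,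
            mul_comm]
  calc ∑ n ∈ u, ∏ i, w (n i)
      ≤ ∑ n ∈ u, ∑ i, (if n ∈ B i then ∏ j, w (n j) else 0) := by
        refine Finset.sum_le_sum fun n hn => ?_
        obtain ⟨i, hi⟩ := hcover n hn
        calc ∏ j, w (n j) = (if n ∈ B i then ∏ j, w (n j) else 0) := by rw [if_pos hi]
          _ ≤ ∑ i', (if n ∈ B i' then ∏ j, w (n j) else 0) :=
              Finset.single_le_sum (f := fun i' => if n ∈ B i' then ∏ j, w (n j) else 0)
                (fun i' _ => by
                  split_ifs
                  · exact hWn n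
                  · exact le_rfl)
                (Finset.mem_univ i)
    _ = ∑ i, ∑ n ∈ u, (if n ∈ B i then ∏ j, w (n j) else 0) := Finset.sum_comm
    _ ≤ ∑ i, ∑ n ∈ B i, ∏ j, w (n j) := by
        refine Finset.sum_le_sum fun i _ => ?_
        rw [← Finset.sum_filter]
        exact Finset.sum_le_sum_of_subset_of_nonneg (fun n hn => (Finset.mem_filter.mp hn).2)
          fun n _ _ => hWn n
    _ ≤ ∑ _i : I, A ^ (Fintype.card I - 1) * T := Finset.sum_le_sum fun i _ => hbox i
    _ = Fintype.card I * A ^ (Fintype.card I - 1) * T := by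
        rw [Finset.sum_const, Finset.card_univ, nsmul_eq_mul]
        ring

/-- **Tail of a product weight outside the box `[-K,K]^I`**: `∑_{n ∉ box} W(n) ≤ |I| A^{|I|-1} T`.
[folklore] -/
theorem tsum_compl_box_le (w : ℤ → ℝ) (hw : ∀ k, 0 ≤ w k) {A T : ℝ}
    (hA : ∀ K' : ℕ, ∑ k ∈ Finset.Icc (-(K' : ℤ)) K', w k ≤ A) (K : ℕ)
    (hT : ∀ K' : ℕ, ∑ k ∈ Finset.Icc (-(K' : ℤ)) K' \ Finset.Icc (-(K : ℤ)) K, w k ≤ T) :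
    ∑' n : ↑((↑(Fintype.piFinset (fun _ : I => Finset.Icc (-(K : ℤ)) K)) : Set (I → ℤ))ᶜ),
        ∏ i, w ((n : I → ℤ) i) ≤ Fintype.card I * A ^ (Fintype.card I - 1) * T := by
  refine Real.tsum_le_of_sum_le (fun n => Finset.prod_nonneg fun i _ => hw _) fun u => ?_
  have h := sum_prod_le_of_not_mem_box w hw hA K hT (u.map (Function.Embedding.subtype _))
    (fun n hn => by
      obtain ⟨m, -, rfl⟩ := Finset.mem_map.mp hn
      have hm := m.2
      rw [Set.mem_compl_iff, Finset.mem_coe] at hm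
      exact hm)
  rwa [Finset.sum_map] at h

end Summit.Parity.GeneralizedHardyLittlewood.GreenTaoLevelTwoMNTwoVerticalWeights
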